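import Mathlib

/-!
# SoloBlind — arithmetic core of the parity lemma P₂ (level 2N, Frobenius-fixed points)

Kernel anchors for LEMMA P₂ / THEOREM K of the solo-blind line (level `2N`, `N ≡ 1 (mod 8)` prime):
the Hecke operator `T_l` vanishes mod 2 on the two `Frob₂`-fixed supersingular points.  The proof
counts norm-`l` elements of an Eichler order `O₁ ⊂ ¼ℤ⟨1, ψ, φ, ψφ⟩` with `ψ² = -2`, `φ² = -N`
anticommuting, norm form `x² + 2y² + N z² + 2N w²`, under the group of all sixteen sign changes.
The facts certified here are:

* `soloBlind_anticommute_forced` — an integer `s` with `2N ∣ s` and `s² < 8N` is `0`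
  (so `ψφ + φψ = 0` is forced by integrality and definiteness);
* `soloBlind_signChanges_generate` — the four sign changes `-1`, conjugation, `Ad ψ`, `Ad φ`
  (rows, as vectors over `𝔽₂`) form an invertible matrix, i.e. generate all of `{±1}⁴`;
* `soloBlind_no_single_coordinate_*` — no element with a single non-zero coordinate has norm `l`
  (in cleared denominators: `x'² = 16 l`, `y'² = 8 l`, `N z'² = 16 l`, `2N w'² = 16 l` are impossible
  for an odd prime `l ≠ N`), so every orbit has size ≥ 4 and the count is divisible by 4.
-/

namespace Summit.Langlands.Langlands.Theorems

/-- If `2 ≤ N`, `2N ∣ s` and `s² < 8N` then `s = 0`: the anticommutation `ψφ + φψ = 0` is forced. -/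
theorem soloBlind_anticommute_forced {N s : ℤ} (hN : 2 ≤ N) (hdvd : 2 * N ∣ s)
    (hlt : s ^ 2 < 8 * N) : s = 0 := by
  obtain ⟨k, rfl⟩ := hdvd
  by_cases hk : k = 0
  · subst hk; ring
  · exfalso
    have hk2 : 0 < k ^ 2 := by positivity
    have hk1 : 1 ≤ k ^ 2 := by omega
    have h4 : 4 * N ^ 2 ≤ (2 * N * k) ^ 2 := by nlinarith
    nlinarith

/-- The sign-change matrix of (`-1`, conjugation, `Ad ψ`, `Ad φ`) on the coordinates `(x,y,z,w)`,
written additively over `𝔽₂` (entry `1` = the coordinate is negated). -/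
def soloBlindSignMatrix : Matrix (Fin 4) (Fin 4) (ZMod 2) :=
  !![1, 1, 1, 1; 0, 1, 1, 1; 0, 0, 1, 1; 0, 1, 0, 1]

/-- The four sign changes generate all sixteen: the matrix is invertible over `𝔽₂` (explicit inverse). -/
theorem soloBlind_signChanges_generate :
    soloBlindSignMatrix * !![1, 1, 0, 0; 0, 1, 1, 0; 0, 1, 0, 1; 0, 1, 1, 1] = 1 ∧
    !![1, 1, 0, 0; 0, 1, 1, 0; 0, 1, 0, 1; 0, 1, 1, 1] * soloBlindSignMatrix = 1 := by
  constructor <;> decide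

/-- An odd prime does not divide a power of two. -/
theorem soloBlind_oddPrime_not_dvd_two_pow {l : ℕ} (hl : l.Prime) (h2 : l ≠ 2) (k : ℕ) :
    ¬ l ∣ 2 ^ k := fun h =>
  h2 ((Nat.prime_dvd_prime_iff_eq hl Nat.prime_two).mp (hl.dvd_of_dvd_pow h))

/-- No norm-`l` element of the form `x·1`: `x'² = 16 l` is impossible for an odd prime `l`. -/
theorem soloBlind_no_single_coordinate_x {l : ℕ} (hl : l.Prime) (h2 : l ≠ 2) (x : ℕ) :
    x ^ 2 ≠ 16 * l := by
  intro h
  have hlx : l ∣ x := hl.dvd_of_dvd_pow (show l ∣ x ^ 2 from ⟨16, by rw [h]; ring⟩)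
  obtain ⟨m, rfl⟩ := hlx
  have h' : l * (l * m ^ 2) = l * 16 := by ring_nf; ring_nf at h; linarith
  have h16 : l * m ^ 2 = 16 := Nat.eq_of_mul_eq_mul_left hl.pos h'
  exact soloBlind_oddPrime_not_dvd_two_pow hl h2 4 ⟨m ^ 2, by rw [h16]; norm_num⟩

/-- No norm-`l` element of the form `y·ψ`: `y'² = 8 l` is impossible for an odd prime `l`. -/
theorem soloBlind_no_single_coordinate_y {l : ℕ} (hl : l.Prime) (h2 : l ≠ 2) (y : ℕ) :
    y ^ 2 ≠ 8 * l := by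
  intro h
  have hly : l ∣ y := hl.dvd_of_dvd_pow (show l ∣ y ^ 2 from ⟨8, by rw [h]; ring⟩)
  obtain ⟨m, rfl⟩ := hly
  have h' : l * (l * m ^ 2) = l * 8 := by ring_nf; ring_nf at h; linarith
  have h8 : l * m ^ 2 = 8 := Nat.eq_of_mul_eq_mul_left hl.pos h'
  exact soloBlind_oddPrime_not_dvd_two_pow hl h2 3 ⟨m ^ 2, by rw [h8]; norm_num⟩

/-- No norm-`l` element of the form `z·φ`: `N z'² = 16 l` is impossible for primes `l ≠ N`, `l` odd. -/
theorem soloBlind_no_single_coordinate_z {l N : ℕ} (hl : l.Prime) (h2 : l ≠ 2) (hN : N.Prime)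
    (hNl : l ≠ N) (z : ℕ) : N * z ^ 2 ≠ 16 * l := by
  intro h
  have hdvd : l ∣ N * z ^ 2 := ⟨16, by rw [h]; ring⟩
  rcases (Nat.Prime.dvd_mul hl).mp hdvd with hN' | hz
  · rcases (Nat.dvd_prime hN).mp hN' with h1 | h1
    · exact hl.one_lt.ne' h1
    · exact hNl h1
  · obtain ⟨m, rfl⟩ := hl.dvd_of_dvd_pow hz
    have h' : l * (N * l * m ^ 2) = l * 16 := by ring_nf; ring_nf at h; linarith
    have h16 : N * l * m ^ 2 = 16 := Nat.eq_of_mul_eq_mul_left hl.pos h'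
    exact soloBlind_oddPrime_not_dvd_two_pow hl h2 4 ⟨N * m ^ 2, by
      ring_nf; ring_nf at h16; linarith⟩

/-- No norm-`l` element of the form `w·ψφ`: `2N w'² = 16 l` is impossible for primes `l ≠ N`, `l` odd. -/
theorem soloBlind_no_single_coordinate_w {l N : ℕ} (hl : l.Prime) (h2 : l ≠ 2) (hN : N.Prime)
    (hNl : l ≠ N) (w : ℕ) : 2 * N * w ^ 2 ≠ 16 * l := by
  intro h
  have hdvd : l ∣ 2 * N * w ^ 2 := ⟨16, by rw [h]; ring⟩
  rcases (Nat.Prime.dvd_mul hl).mp hdvd with h2N | hw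
  · rcases (Nat.Prime.dvd_mul hl).mp h2N with h2' | hN'
    · exact soloBlind_oddPrime_not_dvd_two_pow hl h2 1 (by simpa using h2')
    · rcases (Nat.dvd_prime hN).mp hN' with h1 | h1
      · exact hl.one_lt.ne' h1
      · exact hNl h1
  · obtain ⟨m, rfl⟩ := hl.dvd_of_dvd_pow hw
    have h' : l * (2 * N * l * m ^ 2) = l * 16 := by ring_nf; ring_nf at h; linarith
    have h16 : 2 * N * l * m ^ 2 = 16 := Nat.eq_of_mul_eq_mul_left hl.pos h'
    exact soloBlind_oddPrime_not_dvd_two_pow hl h2 4 ⟨2 * N * m ^ 2, by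
      ring_nf; ring_nf at h16; linarith⟩

end Summit.Langlands.Langlands.Theorems
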